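import Literature.AlgebraicGeometry.Resolution.HenselizedFunctionFieldsImmediate
import HarnessLib

/-!
# The henselization of an algebraic extension is the compositum (Kuhlmann 2019, Lemma 2.1)

Topic: `Literature/AlgebraicGeometry/Resolution` (valued function fields). PROVED, in the ambient
rendering of `Henselization.lean` (`Ω` algebraically closed with valuation ring `V`, subfields
`E ≤ F ≤ Ω`, `E^h = henselization V E`), F.-V. Kuhlmann, *Elimination of ramification II:
Henselian rationality*, Israel J. Math. 234 (2019) = arXiv:1701.05508, **Lemma 2.1**:

> Take an arbitrary algebraic extension `(F|E,v)` and extend `v` to `F̃`. Taking the respective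
> henselizations in `(F̃,v)`, we have that `F^h = F.E^h`. Hence if `F|E` is finite, algebraic or
> separable, then `F^h|E^h` is finite, algebraic or separable, respectively. Further, `(F|E,v)`
> is immediate if and only if `(F^h|E^h,v)` is.
> *Proof.* As an algebraic extension of the henselian field `(E^h,v)`, also `(F.E^h,v)` is
> henselian. It also contains `(F,v)`, so it must contain `(F^h,v)`. On the other hand, `F^h`
> contains `F` and `E`, and must also contain the henselization `E^h`. So `F.E^h ⊆ F^h` and
> equality holds.

This is an ingredient of the proofs of Props. 5.6 and 5.7 of the paper (the decomposition of
`Kuhlmann2019_Thm13_sepClosed`, `Kuhlmann2019HenselianRationalitySteps.lean`).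

## Content (PROVED)

* `henselization_eq_sup_of_isAlgebraic` — `F^h = F ⊔ E^h` for `E ≤ F` algebraic, from
  `Kuhlmann2010HenselizationIsHenselian_holds` (the henselization is henselian), Lemma 2.3 of
  Kuhlmann 2010 (`IsHenselianField.of_subfield_algebraic`: algebraic extensions of henselian
  fields are henselian) and the universal property `henselization_le_of_isHenselianField`.
* `isImmediateOver_henselization_iff` — "`(F|E,v)` is immediate if and only if `(F^h|E^h,v)`
  is" (`Kuhlmann2010HenselizationImmediate_holds`).

## Sources

* F.-V. Kuhlmann, Israel J. Math. 234 (2019) = arXiv:1701.05508, Lemma 2.1 (p. 4).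
* F.-V. Kuhlmann, Trans. AMS 362 (2010) = arXiv:1003.5678, Lemmas 2.2–2.3.
-/

noncomputable section

namespace Literature.AlgebraicGeometry.Resolution

universe u

variable {Ω : Type u} [Field Ω] [IsAlgClosed Ω] (V : ValuationSubring Ω)

/-- **Kuhlmann 2019, Lemma 2.1: `F^h = F.E^h` for an algebraic extension `F|E`.** PROVED along
the print: `F.E^h = F ⊔ E^h` is algebraic over the henselian `E^h`, hence henselian, and contains
`F`, so it contains `F^h`; conversely `F^h ⊇ F` and `F^h ⊇ E^h`. [cite: Kuhlmann2019, Lemma 2.1] -/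
theorem henselization_eq_sup_of_isAlgebraic {E F : Subfield Ω} (hEF : E ≤ F)
    (halg : ∀ a ∈ F, IsAlgebraic E a) :
    henselization V F = F ⊔ henselization V E := by
  have hH := Kuhlmann2010HenselizationIsHenselian_holds.{u}
  refine le_antisymm ?_ (sup_le (le_henselization V F) (henselization_mono V hH hEF))
  -- `F ⊔ E^h` is algebraic over `E^h`, hence henselian
  have hle : henselization V E ≤ F ⊔ henselization V E := le_sup_right
  have halg' : ∀ y ∈ F ⊔ henselization V E, IsAlgebraic (henselization V E) y := by
    intro y hy
    have hy' : y ∈ Subfield.closure ((henselization V E : Set Ω) ∪ (F : Set Ω)) := by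
      rw [Subfield.closure_union, Subfield.closure_eq, Subfield.closure_eq, sup_comm]
      exact hy
    exact isAlgebraic_of_mem_closure
      (fun a ha => isAlgebraic_of_subfield_le (le_henselization V E) (halg a ha)) hy'
  have hhens : IsHenselianField (↥(F ⊔ henselization V E))
      (V.comap (algebraMap (↥(F ⊔ henselization V E)) Ω)) :=
    IsHenselianField.of_subfield_algebraic V hle halg' (hH Ω V E)
  exact henselization_le_of_isHenselianField V F le_sup_left hhens

/-- **Kuhlmann 2019, Lemma 2.1, last clause: `(F|E,v)` is immediate iff `(F^h|E^h,v)` is**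
("just observe that `vF^h = vF`, `F^hv = Fv`, `vE^h = vE` and `E^hv = Ev`",
`Kuhlmann2010HenselizationImmediate_holds`); in the ambient rendering no inclusion `E ≤ F` is
needed. PROVED. [cite: Kuhlmann2019, Lemma 2.1] -/
theorem isImmediateOver_henselization_iff (E F : Subfield Ω) :
    IsImmediateOver V (henselization V E) (henselization V F) ↔ IsImmediateOver V E F := by
  have hI := Kuhlmann2010HenselizationImmediate_holds.{u}
  obtain ⟨hEv, hEr⟩ := hI Ω V E
  obtain ⟨hFv, hFr⟩ := hI Ω V F
  constructor
  · rintro ⟨hv, hr⟩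
    refine ⟨fun a haF ha0 => ?_, ?_⟩
    · obtain ⟨b, hbEh, hab⟩ := hv a (le_henselization V F haF) ha0
      have hb0 : b ≠ 0 := by
        rintro rfl
        rw [map_zero, map_eq_zero] at hab
        exact ha0 hab
      obtain ⟨c, hcE, hbc⟩ := hEv b hbEh hb0
      exact ⟨c, hcE, hab.trans hbc⟩
    · exact ((resField_mono V (le_henselization V F)).trans hr).trans hEr
  · rintro ⟨hv, hr⟩
    refine ⟨fun a haFh ha0 => ?_, ?_⟩
    · obtain ⟨b, hbF, hab⟩ := hFv a haFh ha0
      have hb0 : b ≠ 0 := by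
        rintro rfl
        rw [map_zero, map_eq_zero] at hab
        exact ha0 hab
      obtain ⟨c, hcE, hbc⟩ := hv b hbF hb0
      exact ⟨c, le_henselization V E hcE, hab.trans hbc⟩
    · exact (hFr.trans hr).trans (resField_mono V (le_henselization V E))

end Literature.AlgebraicGeometry.Resolution
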